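import Summits.Ventures.PercRepro.PurePairGraphClusters
import Summits.Ventures.PercRepro.PurePairGraphJoins
import Summits.Ventures.PercRepro.StarGadgetGraphTables
import Summits.Ventures.PercRepro.C026HGraph

/-!
# The pure-pair gadget — modes, cluster memberships and the tables for centrals and hubs (module 3b)

`InMode μ ω`; the cluster memberships of the centrals, the hub vertices and the pair vertices read
off the branch states (`inCl`, `pinCl`); `hadj_cen_cen_iff` (the constant table `T2 true β μ`),
`hadj_cen_hv_iff` (the hub formula `Hf`, via `hf_raw` of `StarGadgetGraphTables`), and the
connectivity of the two vertices of a pair (`conn_pv_pv_iff`).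
-/

namespace PercRepro.PurePairGraph

open MultiGraph StarGadgetGraph

variable {p q r s n : ℕ}

/-! ### Modes and memberships -/

/-- A configuration is in mode `μ`: `Local` (= `bot`) and the centre attaches exactly to the mark
of `μ`. -/
def InMode (μ : Mode) (ω : Config (PE p q r s n)) : Prop :=
  Local ω ∧ ∀ m, Att ω m ↔ μ = some m

/-- The cluster of the mark `m'` contains the mark `m` iff `m = m'`. -/
theorem vm_mem_cluster_vm_iff {ω : Config (PE p q r s n)} (hL : Local ω) (m m' : Fin 3) :
    (vm m : PV p q r s n) ∈ (purePairGadget p q r s n).cluster ω (vm m') ↔ m = m' := by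
  rw [cluster_mark_eq ω hL m', vm_mem_K_iff]

/-- A hub vertex lies in the cluster of the mark `m` iff `inCl`. -/
theorem hv_mem_cluster_vm_iff {μ : Mode} {ω : Config (PE p q r s n)} (hμ : InMode μ ω)
    (m : Fin 3) (h : Hub p q r s) :
    (hv h : PV p q r s n) ∈ (purePairGadget p q r s n).cluster ω (vm m) ↔
      inCl μ m (hubType h) (hubState ω h) := by
  rw [cluster_mark_eq ω hμ.1 m, hv_mem_K_iff, hμ.2 m]
  rfl

/-- A pair vertex lies in the cluster of the mark `m` iff `pinCl`. -/
theorem pv_mem_cluster_vm_iff {μ : Mode} {ω : Config (PE p q r s n)} (hμ : InMode μ ω)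
    (m : Fin 3) (j : Fin n) (w : Bool) :
    (pv j w : PV p q r s n) ∈ (purePairGadget p q r s n).cluster ω (vm m) ↔
      pinCl μ m (pairState ω j) w := by
  rw [cluster_mark_eq ω hμ.1 m, pv_mem_K_iff, hμ.2 m]
  rfl

/-- The centre lies in the cluster of the mark `m` iff the mode is `m`. -/
theorem vx_mem_cluster_vm_iff' {μ : Mode} {ω : Config (PE p q r s n)} (hμ : InMode μ ω)
    (m : Fin 3) : (vx : PV p q r s n) ∈ (purePairGadget p q r s n).cluster ω (vm m) ↔ μ = some m := by
  rw [vx_mem_cluster_mark_iff ω hμ.1 m, hμ.2 m]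

/-- When the centre attaches to `m`, its cluster is the cluster of `m`. -/
theorem cluster_vx_eq_of_att {ω : Config (PE p q r s n)} {m : Fin 3} (hA : Att ω m) :
    (purePairGadget p q r s n).cluster ω vx = (purePairGadget p q r s n).cluster ω (vm m) :=
  cluster_eq_of_conn (purePairGadget p q r s n) (conn_vm_vx_of_att hA).symm

/-- A hub vertex lies in the cluster of the centre iff its `x`-edge is open, or it hangs from the
mark the centre attaches to. -/
theorem hv_mem_cluster_vx_iff {μ : Mode} {ω : Config (PE p q r s n)} (hμ : InMode μ ω)
    (h : Hub p q r s) :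
    (hv h : PV p q r s n) ∈ (purePairGadget p q r s n).cluster ω vx ↔
      xo (hubState ω h) ∨ (¬ xo (hubState ω h) ∧ ∃ m, μ = some m ∧ mo (hubState ω h) m) := by
  rcases hμμ : μ with _ | m
  · have hR : ∀ m, ¬ Att ω m := fun m hA => by simpa [hμμ] using (hμ.2 m).1 hA
    rw [cluster_x_eq ω hR, hv_mem_XR_iff]
    constructor
    · intro hx; exact Or.inl hx
    · rintro (hx | ⟨-, m, hm, -⟩)
      · exact hx
      · cases hm
  · have hA : Att ω m := (hμ.2 m).2 hμμ
    rw [cluster_vx_eq_of_att hA, cluster_mark_eq ω hμ.1 m, hv_mem_K_iff]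
    constructor
    · rintro (⟨hx, hm⟩ | ⟨-, hx⟩)
      · exact Or.inr ⟨hx, m, rfl, hm⟩
      · exact Or.inl hx
    · rintro (hx | ⟨hx, m', hm', hmo⟩)
      · exact Or.inr ⟨hA, hx⟩
      · obtain rfl := Option.some.inj hm'
        exact Or.inl ⟨hx, hmo⟩

/-- A pair vertex lies in the cluster of the centre iff it reaches `x` inside its pair, or (mode M)
it reaches `c` inside its pair. -/
theorem pv_mem_cluster_vx_iff {μ : Mode} {ω : Config (PE p q r s n)} (hμ : InMode μ ω)
    (j : Fin n) (w : Bool) :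
    (pv j w : PV p q r s n) ∈ (purePairGadget p q r s n).cluster ω vx ↔
      xatt (pairState ω j) w ∨ (μ = some 2 ∧ catt (pairState ω j) w) := by
  rcases hμμ : μ with _ | m
  · have hR : ∀ m, ¬ Att ω m := fun m hA => by simpa [hμμ] using (hμ.2 m).1 hA
    rw [cluster_x_eq ω hR, pv_mem_XR_iff]
    constructor
    · intro hx; exact Or.inl hx
    · rintro (hx | ⟨h, -⟩)
      · exact hx
      · cases h
  · have hA : Att ω m := (hμ.2 m).2 hμμ
    rw [cluster_vx_eq_of_att hA, cluster_mark_eq ω hμ.1 m, pv_mem_K_iff]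
    constructor
    · rintro (⟨rfl, hc⟩ | ⟨-, hx⟩)
      · exact Or.inr ⟨rfl, hc⟩
      · exact Or.inl hx
    · rintro (hx | ⟨h2, hc⟩)
      · exact Or.inr ⟨hA, hx⟩
      · obtain rfl := Option.some.inj h2
        exact Or.inl ⟨rfl, hc⟩

/-- The central `i` lies in `M = cluster ω c` iff `i = c`, or `i = x` in mode M. -/
theorem cen_mem_M_iff {μ : Mode} {ω : Config (PE p q r s n)} (hμ : InMode μ ω) (i : Fin 4) :
    (cen i : PV p q r s n) ∈ (purePairGadget p q r s n).cluster ω (vm 2) ↔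
      i = 2 ∨ (i = 3 ∧ μ = some 2) := by
  rcases cen_cases i with ⟨m, rfl⟩ | rfl
  · rw [cen_castSucc, vm_mem_cluster_vm_iff hμ.1]
    have h3 : (m.castSucc : Fin 4) ≠ 3 := by revert m; decide
    simp only [h3, false_and, or_false]
    revert m; decide
  · rw [cen_last, vx_mem_cluster_vm_iff' hμ]
    simp

/-- Two centrals are connected iff equal, or one is the centre and the other the mark it attaches
to. -/
theorem conn_cen_cen_iff {μ : Mode} {ω : Config (PE p q r s n)} (hμ : InMode μ ω) (i j : Fin 4) :
    (purePairGadget p q r s n).Conn ω (cen i) (cen j) ↔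
      i = j ∨ (i = 3 ∧ ∃ m, j = m.castSucc ∧ μ = some m) ∨
        (j = 3 ∧ ∃ m, i = m.castSucc ∧ μ = some m) := by
  rcases cen_cases i with ⟨m, rfl⟩ | rfl <;> rcases cen_cases j with ⟨m', rfl⟩ | rfl
  · rw [cen_castSucc, cen_castSucc, ← mem_cluster, vm_mem_cluster_vm_iff hμ.1]
    have h1 : ∀ m : Fin 3, (m.castSucc : Fin 4) ≠ 3 := by decide
    simp only [h1, false_and, or_false, Fin.castSucc_inj]
    rw [eq_comm]
  · rw [cen_castSucc, cen_last, ← mem_cluster, vx_mem_cluster_vm_iff' hμ]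
    have h1 : ∀ m : Fin 3, (m.castSucc : Fin 4) ≠ 3 := by decide
    simp [h1, Fin.castSucc_inj]
  · rw [cen_last, cen_castSucc, conn_comm, ← mem_cluster, vx_mem_cluster_vm_iff' hμ]
    have h1 : ∀ m : Fin 3, (m.castSucc : Fin 4) ≠ 3 := by decide
    have h2 : ∀ m : Fin 3, (3 : Fin 4) ≠ m.castSucc := by decide
    simp [h1, h2, Fin.castSucc_inj]
  · simp [Conn.refl]

set_option synthInstance.maxSize 4096 in
/-- **Central–central H-adjacency** is the constant table `T2 true β μ` (distinct centrals). -/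
theorem hadj_cen_cen_iff {μ : Mode} {ω : Config (PE p q r s n)} (hμ : InMode μ ω) {β : Bool}
    (hβ : cxOpen ω ↔ β = true) (i j : Fin 4) (hij : i ≠ j) :
    (purePairGadget p q r s n).HAdj ω (vm 2) (cen i) (cen j) ↔ T2 true β μ i j = true := by
  unfold HAdj
  rw [cen_mem_M_iff hμ, cen_mem_M_iff hμ, conn_cen_cen_iff hμ]
  have e1 : (∃ e, ω e = false ∧ (purePairGadget p q r s n).Joins e (cen i) (cen j)) ↔
      ((i = 2 ∧ j = 3) ∨ (i = 3 ∧ j = 2)) ∧ β = false := by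
    rw [exists_joins_cen_cen_iff, cx_closed_iff, hβ]
    cases β <;> simp
  have e2 : (∃ e, (purePairGadget p q r s n).Joins e (cen i) (cen j)) ↔
      ((i = 2 ∧ j = 3) ∨ (i = 3 ∧ j = 2)) := by
    have := exists_joins_cen_cen_iff (p := p) (q := q) (r := r) (s := s) (n := n)
      (fun _ => True) i j
    simp only [true_and, and_true] at this
    rw [this]
  rw [e1, e2]
  clear e1 e2 hβ hμ ω
  revert hij
  revert i j
  revert β μ
  decide +kernel

/-- **Central–hub H-adjacency** is the hub profile formula `Hf` (via `hf_raw`). -/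
theorem hadj_cen_hv_iff {μ : Mode} {ω : Config (PE p q r s n)} (hμ : InMode μ ω) (i : Fin 4)
    (h : Hub p q r s) :
    (purePairGadget p q r s n).HAdj ω (vm 2) (cen i) (hv h) ↔ Hf μ i (hubType h) (hubState ω h) := by
  unfold HAdj
  rw [cen_mem_M_iff hμ, hv_mem_cluster_vm_iff hμ 2]
  have e1 : (∃ e, ω e = false ∧ (purePairGadget p q r s n).Joins e (cen i) (hv h)) ↔
      (i = 3 ∧ ¬ xo (hubState ω h)) ∨
        ∃ m, i = m.castSucc ∧ hasM (hubType h) m ∧ ¬ mo (hubState ω h) m := by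
    rcases cen_cases i with ⟨m, rfl⟩ | rfl
    · rw [cen_castSucc, exists_joins_vm_hv_iff]
      refine (exists_closed_mark_iff (hubType h) (hubState ω h) m).trans ?_
      have h1 : ∀ m : Fin 3, (m.castSucc : Fin 4) ≠ 3 := by decide
      simp [h1, Fin.castSucc_inj]
    · rw [cen_last, exists_joins_vx_hv_iff]
      have h1 : ∀ m : Fin 3, (3 : Fin 4) ≠ m.castSucc := by decide
      simp only [h1, false_and, exists_false, or_false, true_and]
      show ω (Sum.inr ⟨Sum.inl h, none⟩) = false ↔ ¬ ω (Sum.inr ⟨Sum.inl h, none⟩) = true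
      cases ω (Sum.inr ⟨Sum.inl h, none⟩) <;> simp
  have e2 : (∃ e, (purePairGadget p q r s n).Joins e (cen i) (hv h)) ↔
      i = 3 ∨ ∃ m, i = m.castSucc ∧ hasM (hubType h) m := by
    rcases cen_cases i with ⟨m, rfl⟩ | rfl
    · rw [cen_castSucc]
      have := exists_joins_vm_hv_iff (p := p) (q := q) (r := r) (s := s) (n := n)
        (fun _ => True) m h
      simp only [true_and, and_true] at this
      rw [this, exists_mark_iff]
      have h1 : ∀ m : Fin 3, (m.castSucc : Fin 4) ≠ 3 := by decide
      simp [h1, Fin.castSucc_inj]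
    · rw [cen_last]
      have := exists_joins_vx_hv_iff (p := p) (q := q) (r := r) (s := s) (n := n)
        (fun _ => True) h
      simp only [true_and] at this
      rw [this]
      simp
  have e3 : (purePairGadget p q r s n).Conn ω (cen i) (hv h) ↔
      (i = 3 ∧ (xo (hubState ω h) ∨
        (¬ xo (hubState ω h) ∧ ∃ m, μ = some m ∧ mo (hubState ω h) m))) ∨
        ∃ m, i = m.castSucc ∧ inCl μ m (hubType h) (hubState ω h) := by
    rcases cen_cases i with ⟨m, rfl⟩ | rfl
    · rw [cen_castSucc, ← mem_cluster, hv_mem_cluster_vm_iff hμ]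
      have h1 : ∀ m : Fin 3, (m.castSucc : Fin 4) ≠ 3 := by decide
      simp [h1, Fin.castSucc_inj]
    · rw [cen_last, ← mem_cluster, hv_mem_cluster_vx_iff hμ]
      have h1 : ∀ m : Fin 3, (3 : Fin 4) ≠ m.castSucc := by decide
      simp [h1]
  rw [e1, e2, e3]
  exact hf_raw μ i (hubType h) (hubState ω h)

/-- A pair vertex with closed `u – v`, closed x-edge and closed c-edge is isolated. -/
theorem isolated_pv {ω : Config (PE p q r s n)} {j : Fin n} {w : Bool}
    (huv : ¬ puv (pairState ω j)) (hx : ¬ pxo (pairState ω j) w) (hc : ¬ pco (pairState ω j) w) :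
    ∀ e, ω e = true → (purePairGadget p q r s n).fst e ≠ pv j w ∧
      (purePairGadget p q r s n).snd e ≠ pv j w := by
  intro e he
  rcases edge_cases e with ⟨rfl, h1, h2⟩ | ⟨h', rfl, h1, h2⟩ | ⟨h', k, rfl, h1, h2⟩ |
    ⟨j', rfl, h1, h2⟩ | ⟨j', w', rfl, h1, h2⟩ | ⟨j', w', rfl, h1, h2⟩ <;> rw [h1, h2]
  · exact ⟨vm_ne_pv _ _ _, vx_ne_pv _ _⟩
  · exact ⟨vx_ne_pv _ _, hv_ne_pv _ _ _⟩
  · exact ⟨vm_ne_pv _ _ _, hv_ne_pv _ _ _⟩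
  · refine ⟨fun h => ?_, fun h => ?_⟩
    · obtain ⟨rfl, -⟩ := pv_inj.1 h
      exact huv he
    · obtain ⟨rfl, -⟩ := pv_inj.1 h
      exact huv he
  · refine ⟨vx_ne_pv _ _, fun h => ?_⟩
    obtain ⟨rfl, rfl⟩ := pv_inj.1 h
    exact hx he
  · refine ⟨vm_ne_pv _ _ _, fun h => ?_⟩
    obtain ⟨rfl, rfl⟩ := pv_inj.1 h
    exact hc he

/-- The two vertices of a pair are connected iff `u – v` is open, both lie in `M`, or both reach
the centre inside the pair. -/
theorem conn_pv_pv_iff {μ : Mode} {ω : Config (PE p q r s n)} (hμ : InMode μ ω) (j : Fin n) :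
    (purePairGadget p q r s n).Conn ω (pv j false) (pv j true) ↔
      puv (pairState ω j) ∨ (pinCl μ 2 (pairState ω j) false ∧ pinCl μ 2 (pairState ω j) true) ∨
        (xatt (pairState ω j) false ∧ xatt (pairState ω j) true) := by
  constructor
  · intro hconn
    by_cases hM : pinCl μ 2 (pairState ω j) false
    · have h1 : (pv j false : PV p q r s n) ∈ (purePairGadget p q r s n).cluster ω (vm 2) :=
        (pv_mem_cluster_vm_iff hμ 2 j false).2 hM
      have h2 : (pv j true : PV p q r s n) ∈ (purePairGadget p q r s n).cluster ω (vm 2) :=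
        (h1 : (purePairGadget p q r s n).Conn ω (vm 2) (pv j false)).trans hconn
      exact Or.inr (Or.inl ⟨hM, (pv_mem_cluster_vm_iff hμ 2 j true).1 h2⟩)
    · by_cases hx : xatt (pairState ω j) false
      · have h1 : (pv j false : PV p q r s n) ∈ (purePairGadget p q r s n).cluster ω vx :=
          (pv_mem_cluster_vx_iff hμ j false).2 (Or.inl hx)
        have h2 : (pv j true : PV p q r s n) ∈ (purePairGadget p q r s n).cluster ω vx :=
          (h1 : (purePairGadget p q r s n).Conn ω vx (pv j false)).trans hconn
        rcases (pv_mem_cluster_vx_iff hμ j true).1 h2 with hx' | ⟨h2', hc⟩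
        · exact Or.inr (Or.inr ⟨hx, hx'⟩)
        · -- `v ∈ M` in mode M, hence `u ∈ M`: contradiction
          have hvM : (pv j true : PV p q r s n) ∈ (purePairGadget p q r s n).cluster ω (vm 2) :=
            (pv_mem_cluster_vm_iff hμ 2 j true).2 (Or.inl ⟨rfl, hc⟩)
          have huM : (pv j false : PV p q r s n) ∈ (purePairGadget p q r s n).cluster ω (vm 2) :=
            (hvM : (purePairGadget p q r s n).Conn ω (vm 2) (pv j true)).trans hconn.symm
          exact absurd ((pv_mem_cluster_vm_iff hμ 2 j false).1 huM) hM
      · by_cases huv : puv (pairState ω j)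
        · exact Or.inl huv
        · exfalso
          have hpx : ¬ pxo (pairState ω j) false := fun h => hx (xatt_of_pxo h)
          have hpc : ¬ pco (pairState ω j) false := fun h => hM (Or.inl ⟨rfl, catt_of_pco h⟩)
          have := eq_of_conn_of_isolated (isolated_pv huv hpx hpc) hconn
          exact absurd (pv_inj.1 this).2 (by decide)
  · rintro (huv | ⟨hu, hv⟩ | ⟨hu, hv⟩)
    · exact conn_pv_pv_of_puv huv true
    · have h1 := (pv_mem_cluster_vm_iff hμ 2 j false).2 hu
      have h2 := (pv_mem_cluster_vm_iff hμ 2 j true).2 hv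
      exact (h1 : (purePairGadget p q r s n).Conn ω (vm 2) (pv j false)).symm.trans h2
    · exact (conn_vx_pv_of_xatt hu).symm.trans (conn_vx_pv_of_xatt hv)

end PercRepro.PurePairGraph
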